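import Summits.QuantumFields.BalabanUV.Beta.GAN24.FibreSymbols
import Literature.MathematicalPhysics.QuantumFieldTheory.Balaban1983to89.Beta.BlochFibreMatrix
import Mathlib.Analysis.Fourier.ZMod

/-!
# `BalabanUV.Beta.GAN24.FibreDFT` — binder row G-an2-4 / (CONV-C), road P1-fibre, leaf P1-L04a (part 1/2) of the
# `SKELETON-P1` leaf table: the (twisted) BOX DFT on `TorusSite D N → ℂ` — plane waves at the fine momenta, orthogonality, inversion

NOT IN PRINT; OUR PROOF ATTEMPT.  HONEST FRAMING (cell contract, verbatim): «discharging `BetaPertH` makes Bałaban's UV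
stability UNCONDITIONAL — a real constructive-QFT result; it is NOT the continuum limit and NOT the Clay problem.»  HONEST
DEPENDENCY (verbatim): «continuum YM on T⁴ ⇐ BetaPertH ∧ nine spine estimates (0/9 proved); BetaPertH ⇐ (D1) ∧ (D4) ∧ CAP+tail;
G-an2-4 gates asym, D1 and NE2/3/4.»  [folklore] finite Fourier analysis on the box `(ℤ/N)^D` (no estimate, no cited fact, no wall
binder).  NOT summit progress; this leaf discharges nothing of (CONV-C) by itself.

## What is proved (generic dimension `D`, block size `N ≥ 1`, COMPLEX quasi-momentum `p : Fin D → ℂ`)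

Fine momenta `kFine p m := (p + 2π·repZ m)/N`, `m ∈ TorusSite D N = (ℤ/N)^D` (the alias lattice of S1a of `SKELETON-P1.md`).
* §1 plane-wave algebra for `FibreSymbols.pw` (`pw_add`, `pw_neg`, `pw_sub_site`; `blochChar p = pw p` by `rfl`);
* §2 `boxChar m z = Π_μ e_N(m_μ z_μ)` (product of Mathlib's `ZMod.stdAddChar`), its plane-wave form (`boxChar_proj`, `boxChar_eq_pw`)
  and the ORTHOGONALITY relations `Σ_m boxChar m t = [t = 0]·N^D` (`sum_boxChar`, `sum_boxChar'`), from the primitivity of `stdAddChar`;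
* §3 the plane waves `pw (kFine p m)`: on the box they factor as `pw (p/N) · boxChar m` (`pw_kFine`, `pw_kFine_repZ`), they are
  `blochChar p`-Bloch (`pw_kFine_add_zsmul`, `isBloch_pw_kFine`, `pw_kFine_site`), and they satisfy the two orthogonality relations
  `Σ_m pw(k_m)(r_{z'})·pw(−k_m)(r_z) = [z = z']·N^D` (`sum_pw_kFine_mul_pw_neg`), `Σ_z pw(−k_m)(r_z)·pw(k_{m'})(r_z) = [m = m']·N^D`
  (`sum_pw_neg_mul_pw_kFine`) — the `p`-twists cancel, so everything holds for COMPLEX `p` (usable on a strip);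
* §4 the `p`-twisted BOX DFT `amp p w m := N^{−D} Σ_z w z · pw (−k_m) (repZ z)` and the synthesis `synth p a z := Σ_m a m · pw (k_m) (repZ z)`
  are inverse to each other: `synth_amp` (interpolation) and `amp_synth` (uniqueness of amplitudes), `amp_unique`, `amp_injective`;
* §5 matrix form for leaf P1-L04c: `synthMat p * ampMat p = 1`, `ampMat p * synthMat p = 1`, `synthMat_mulVec`, `ampMat_mulVec`.
Part 2/2 (`GAN24/FibreDFTDictionary`): Plancherel at real `p` and the BLOCH DICTIONARY for `BlochFibreMatrix.tens (blochChar p) v`.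
-/

noncomputable section

open Complex Finset
open scoped BigOperators Real ComplexConjugate
open Literature.Probability.LatticeModels (TorusSite Torus.proj Torus.proj_apply)
open Literature.MathematicalPhysics.QuantumFieldTheory.LatticeForm (IsBloch repZ proj_repZ proj_add_zsmul quo)
open Literature.MathematicalPhysics.QuantumFieldTheory.Balaban1983to89.Beta
open AffineAveraging (Site Form0 Form1)
open BlochFibreMatrix (Idx Cfg cfgA cfgμ cfgφ tens blochChar blochChar_apply eq_repZ_add_zsmul_quo)
open BlochFibreUniqueness (quo_repZ quo_add_zsmul isBloch_iff)
open Summit.QuantumFields.BalabanUV.Beta.GAN24.FibreSymbols (pw pw0 pw1)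

namespace Summit.QuantumFields.BalabanUV.Beta.GAN24.FibreDFT

variable {D N : ℕ}

/-! ## §1 Plane-wave algebra -/

/-- [folklore] `pw (k + k') x = pw k x · pw k' x`. -/
theorem pw_add (k k' : Fin D → ℂ) (x : Site D) : pw (k + k') x = pw k x * pw k' x := by
  unfold pw
  rw [← Complex.exp_add]
  congr 1
  simp only [Pi.add_apply, add_mul, Finset.sum_add_distrib, mul_add]

/-- [folklore] `pw (−k) x = (pw k x)⁻¹`. -/
theorem pw_neg (k : Fin D → ℂ) (x : Site D) : pw (-k) x = (pw k x)⁻¹ := by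
  unfold pw
  rw [← Complex.exp_neg]
  congr 1
  simp only [Pi.neg_apply, neg_mul, Finset.sum_neg_distrib, mul_neg]

/-- [folklore] Plane waves never vanish. -/
theorem pw_ne_zero (k : Fin D → ℂ) (x : Site D) : pw k x ≠ 0 := Complex.exp_ne_zero _

/-- [folklore] `pw k 0 = 1`. -/
theorem pw_zero_site (k : Fin D → ℂ) : pw k (0 : Site D) = 1 := by
  simp [pw]

/-- [folklore] `pw k (x − y) = pw k x · pw (−k) y`. -/
theorem pw_sub_site (k : Fin D → ℂ) (x y : Site D) : pw k (x - y) = pw k x * pw (-k) y := by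
  rw [pw_neg]
  unfold pw
  rw [← Complex.exp_neg, ← Complex.exp_add]
  congr 1
  simp only [Pi.sub_apply, Int.cast_sub, mul_sub, Finset.sum_sub_distrib, mul_sub]
  ring

/-- [folklore] The Bloch character IS the coarse plane wave: `blochChar p y = pw p y`. -/
theorem blochChar_eq_pw (p : Fin D → ℂ) (y : Site D) : blochChar p y = pw p y := rfl

/-! ## §2 The box character `e_N(m·z)` and its orthogonality -/

variable [NeZero N]

/-- [folklore] The box character `boxChar m z = Π_μ exp(2πi m_μ z_μ / N)` on `(ℤ/N)^D × (ℤ/N)^D` (product of Mathlib's standard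
additive character `ZMod.stdAddChar`). -/
def boxChar (m z : TorusSite D N) : ℂ := ∏ μ, ZMod.stdAddChar (m μ * z μ)

/-- [folklore] Symmetry `boxChar m z = boxChar z m`. -/
theorem boxChar_comm (m z : TorusSite D N) : boxChar m z = boxChar z m := by
  unfold boxChar
  exact Finset.prod_congr rfl fun μ _ => by rw [mul_comm]

/-- [folklore] One-dimensional orthogonality: `Σ_{j ∈ ℤ/N} e_N(t j) = [t = 0]·N`. -/
theorem sum_stdAddChar_mul (t : ZMod N) :
    ∑ j : ZMod N, ZMod.stdAddChar (t * j) = if t = 0 then (N : ℂ) else 0 := by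
  split_ifs with h
  · simp only [h, zero_mul, AddChar.map_zero_eq_one, Finset.sum_const, Finset.card_univ, ZMod.card,
      nsmul_eq_mul, mul_one]
  · exact AddChar.sum_eq_zero_of_ne_one (ZMod.isPrimitive_stdAddChar N h)

/-- [folklore] ORTHOGONALITY of the box characters: `Σ_m boxChar m t = [t = 0]·N^D`. -/
theorem sum_boxChar (t : TorusSite D N) :
    ∑ m : TorusSite D N, boxChar m t = if t = 0 then (N : ℂ) ^ D else 0 := by
  have h := Fintype.prod_sum (fun (μ : Fin D) (j : ZMod N) => ZMod.stdAddChar (t μ * j))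
  -- `h : ∏ μ, ∑ j, e(t μ * j) = ∑ m, ∏ μ, e(t μ * m μ)`
  have h' : ∑ m : TorusSite D N, boxChar m t = ∏ μ, ∑ j : ZMod N, ZMod.stdAddChar (t μ * j) := by
    rw [h]
    refine Finset.sum_congr rfl fun m _ => Finset.prod_congr rfl fun μ _ => by rw [mul_comm]
  rw [h']
  simp_rw [sum_stdAddChar_mul]
  split_ifs with ht
  · simp [ht]
  · obtain ⟨μ, hμ⟩ : ∃ μ, t μ ≠ (0 : TorusSite D N) μ := Function.ne_iff.mp ht
    exact Finset.prod_eq_zero (Finset.mem_univ μ) (if_neg hμ)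

/-- [folklore] The dual orthogonality `Σ_z boxChar m z = [m = 0]·N^D`. -/
theorem sum_boxChar' (m : TorusSite D N) :
    ∑ z : TorusSite D N, boxChar m z = if m = 0 then (N : ℂ) ^ D else 0 := by
  rw [← sum_boxChar m]
  exact Finset.sum_congr rfl fun z _ => boxChar_comm m z

/-- [folklore] Integer representatives reduce back: `(repZ z μ : ZMod N) = z μ`. -/
theorem intCast_repZ (z : TorusSite D N) (μ : Fin D) : ((repZ z μ : ℤ) : ZMod N) = z μ := by
  simp [repZ]

/-- [folklore] The product character at integer vectors is a plane wave: `Π_μ e_N(s_μ t_μ) = pw (2π s/N) t`. -/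
theorem prod_stdAddChar_intCast (s t : Site D) :
    ∏ μ, ZMod.stdAddChar (((s μ : ℤ) : ZMod N) * ((t μ : ℤ) : ZMod N))
      = pw (fun μ => 2 * π * (s μ : ℂ) / (N : ℂ)) t := by
  unfold pw
  rw [Finset.mul_sum, Complex.exp_sum]
  refine Finset.prod_congr rfl fun μ _ => ?_
  rw [← Int.cast_mul, ZMod.stdAddChar_coe]
  congr 1
  push_cast
  ring

/-- [folklore] `boxChar m (proj x) = pw (2π·repZ m/N) x` for every `x ∈ ℤ^D`. -/
theorem boxChar_proj (m : TorusSite D N) (x : Site D) :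
    boxChar m (Torus.proj N x) = pw (fun μ => 2 * π * (repZ m μ : ℂ) / (N : ℂ)) x := by
  rw [← prod_stdAddChar_intCast (N := N) (repZ m) x]
  unfold boxChar
  refine Finset.prod_congr rfl fun μ _ => ?_
  rw [intCast_repZ, Torus.proj_apply]

/-- [folklore] `boxChar m z = pw (2π·repZ m/N) (repZ z)`. -/
theorem boxChar_eq_pw (m z : TorusSite D N) :
    boxChar m z = pw (fun μ => 2 * π * (repZ m μ : ℂ) / (N : ℂ)) (repZ z) := by
  rw [← boxChar_proj (N := N) m (repZ z), proj_repZ]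

/-! ## §3 Fine momenta `k_m = (p + 2π m)/N` and their plane waves on the box -/

/-- [folklore] The FINE MOMENTUM of the alias class `m ∈ (ℤ/N)^D` above the quasi-momentum `p`: `k_m = (p + 2π·repZ m)/N`
(S1a of `SKELETON-P1.md`). -/
def kFine (p : Fin D → ℂ) (m : TorusSite D N) : Fin D → ℂ :=
  fun μ => (p μ + 2 * π * (repZ m μ : ℂ)) / (N : ℂ)

omit [NeZero N] in
/-- [folklore] `k_m = p/N + 2π·repZ m/N`. -/
theorem kFine_eq_add (p : Fin D → ℂ) (m : TorusSite D N) :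
    kFine p m = (fun μ => p μ / (N : ℂ)) + fun μ => 2 * π * (repZ m μ : ℂ) / (N : ℂ) := by
  funext μ
  simp only [kFine, Pi.add_apply, add_div]

/-- [folklore] ON THE BOX the fine plane wave factors as twist × box character: `pw k_m x = pw (p/N) x · boxChar m (proj x)`. -/
theorem pw_kFine (p : Fin D → ℂ) (m : TorusSite D N) (x : Site D) :
    pw (kFine p m) x = pw (fun μ => p μ / (N : ℂ)) x * boxChar m (Torus.proj N x) := by
  rw [kFine_eq_add, pw_add, boxChar_proj]

/-- [folklore] The same at a box representative: `pw k_m (repZ z) = pw (p/N) (repZ z) · boxChar m z`. -/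
theorem pw_kFine_repZ (p : Fin D → ℂ) (m z : TorusSite D N) :
    pw (kFine p m) (repZ z) = pw (fun μ => p μ / (N : ℂ)) (repZ z) * boxChar m z := by
  rw [pw_kFine, proj_repZ]

/-- [folklore] BLOCH PROPERTY of the fine plane waves: `pw k_m (x + N•a) = blochChar p a · pw k_m x` (the alias phases
`exp(2πi m·a)` are `1`). -/
theorem pw_kFine_add_zsmul (p : Fin D → ℂ) (m : TorusSite D N) (x a : Site D) :
    pw (kFine p m) (x + (N : ℤ) • a) = blochChar p a * pw (kFine p m) x := by
  have hN : (N : ℂ) ≠ 0 := Nat.cast_ne_zero.2 (NeZero.ne N)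
  rw [blochChar_apply]
  unfold pw kFine
  rw [← Complex.exp_add]
  have key : I * ∑ μ, (p μ + 2 * π * (repZ m μ : ℂ)) / (N : ℂ) * (((x + (N : ℤ) • a) μ : ℤ) : ℂ)
      = (I * ∑ μ, p μ * (a μ : ℂ) + I * ∑ μ, (p μ + 2 * π * (repZ m μ : ℂ)) / (N : ℂ) * (x μ : ℂ))
        + ((∑ μ, repZ m μ * a μ : ℤ) : ℂ) * (2 * π * I) := by
    push_cast
    simp only [Pi.add_apply, Pi.smul_apply, smul_eq_mul, Int.cast_add, Int.cast_mul, Int.cast_natCast, Finset.mul_sum,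
      Finset.sum_mul, ← Finset.sum_add_distrib]
    refine Finset.sum_congr rfl fun μ _ => ?_
    field_simp
    ring
  rw [key, Complex.exp_add, Complex.exp_int_mul_two_pi_mul_I, mul_one]

/-- [folklore] The fine plane wave `pw k_m` is `blochChar p`-Bloch with respect to `N•ℤ^D`. -/
theorem isBloch_pw_kFine (p : Fin D → ℂ) (m : TorusSite D N) : IsBloch N (⇑(blochChar p)) (pw (kFine p m)) := by
  rw [isBloch_iff]
  intro x a
  exact pw_kFine_add_zsmul p m x a

/-- [folklore] Reading a fine plane wave at a fine point through its block/box coordinates: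
`pw k_m x = blochChar p (quo N x) · pw k_m (repZ (proj N x))`. -/
theorem pw_kFine_site (p : Fin D → ℂ) (m : TorusSite D N) (x : Site D) :
    pw (kFine p m) x = blochChar p (quo N x) * pw (kFine p m) (repZ (Torus.proj N x)) := by
  conv_lhs => rw [eq_repZ_add_zsmul_quo (N := N) x]
  exact pw_kFine_add_zsmul p m _ _

/-- [folklore] ORTHOGONALITY OVER THE ALIAS LATTICE: `Σ_m pw k_m (repZ z') · pw (−k_m) (repZ z) = [z = z']·N^D` (the `p`-twists cancel
at `z = z'`). -/
theorem sum_pw_kFine_mul_pw_neg (p : Fin D → ℂ) (z z' : TorusSite D N) :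
    ∑ m : TorusSite D N, pw (kFine p m) (repZ z') * pw (-kFine p m) (repZ z)
      = if z = z' then (N : ℂ) ^ D else 0 := by
  have h : ∀ m : TorusSite D N, pw (kFine p m) (repZ z') * pw (-kFine p m) (repZ z)
      = pw (fun μ => p μ / (N : ℂ)) (repZ z' - repZ z) * boxChar m (z' - z) := by
    intro m
    rw [← pw_sub_site, pw_kFine]
    congr 2
    funext μ
    simp only [Torus.proj_apply, Pi.sub_apply, Int.cast_sub]
    rw [← Torus.proj_apply N (repZ z') μ, ← Torus.proj_apply N (repZ z) μ, proj_repZ, proj_repZ]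
  simp_rw [h]
  rw [← Finset.mul_sum, sum_boxChar]
  by_cases hz : z = z'
  · subst hz
    simp [pw_zero_site]
  · have hz' : z' - z ≠ 0 := fun h0 => hz (sub_eq_zero.mp h0).symm
    rw [if_neg hz', if_neg hz, mul_zero]

/-- [folklore] ORTHOGONALITY OVER THE BOX: `Σ_z pw (−k_m) (repZ z) · pw (k_{m'}) (repZ z) = [m = m']·N^D` (the `p`-twists cancel
identically, for every complex `p`). -/
theorem sum_pw_neg_mul_pw_kFine (p : Fin D → ℂ) (m m' : TorusSite D N) :
    ∑ z : TorusSite D N, pw (-kFine p m) (repZ z) * pw (kFine p m') (repZ z)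
      = if m = m' then (N : ℂ) ^ D else 0 := by
  have h : ∀ z : TorusSite D N, pw (-kFine p m) (repZ z) * pw (kFine p m') (repZ z) = boxChar (m' - m) z := by
    intro z
    rw [← pw_add]
    have hk : -kFine p m + kFine p m' = fun μ => 2 * π * (((repZ m' - repZ m) μ : ℤ) : ℂ) / (N : ℂ) := by
      funext μ
      simp only [Pi.add_apply, Pi.neg_apply, Pi.sub_apply, kFine, Int.cast_sub]
      ring
    rw [hk, ← prod_stdAddChar_intCast (N := N) (repZ m' - repZ m) (repZ z)]
    unfold boxChar
    refine Finset.prod_congr rfl fun μ _ => ?_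
    simp only [Pi.sub_apply, Int.cast_sub, intCast_repZ]
  simp_rw [h]
  rw [sum_boxChar']
  by_cases hm : m = m'
  · subst hm
    simp
  · have hm' : m' - m ≠ 0 := fun h0 => hm (sub_eq_zero.mp h0).symm
    rw [if_neg hm', if_neg hm]

/-! ## §4 The (twisted) box DFT and its inverse -/

/-- [folklore] THE BOX DFT (analysis), twisted by `p`: the amplitude of the alias class `m` in the box data `w`,
`amp p w m = N^{−D} · Σ_z w z · pw (−k_m) (repZ z)`.  For `p = 0` this is the plain `D`-dimensional DFT on `(ℤ/N)^D`
(normalised by `N^{−D}`). -/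
def amp (p : Fin D → ℂ) (w : TorusSite D N → ℂ) (m : TorusSite D N) : ℂ :=
  ((N : ℂ) ^ D)⁻¹ * ∑ z : TorusSite D N, w z * pw (-kFine p m) (repZ z)

/-- [folklore] THE SYNTHESIS (inverse box DFT): the plane-wave superposition with amplitudes `a`, read on the box,
`synth p a z = Σ_m a m · pw (k_m) (repZ z)`. -/
def synth (p : Fin D → ℂ) (a : TorusSite D N → ℂ) (z : TorusSite D N) : ℂ :=
  ∑ m : TorusSite D N, a m * pw (kFine p m) (repZ z)

/-- [folklore] `N^D ≠ 0` in `ℂ`. -/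
theorem pow_card_ne_zero : ((N : ℂ) ^ D) ≠ 0 := pow_ne_zero _ (Nat.cast_ne_zero.2 (NeZero.ne N))

/-- [folklore] **INVERSION (interpolation).**  Synthesising the amplitudes of `w` gives back `w`: `synth p (amp p w) = w`. -/
theorem synth_amp (p : Fin D → ℂ) (w : TorusSite D N → ℂ) : synth p (amp p w) = w := by
  funext z'
  unfold synth amp
  calc ∑ m : TorusSite D N, ((N : ℂ) ^ D)⁻¹ * (∑ z, w z * pw (-kFine p m) (repZ z)) * pw (kFine p m) (repZ z')
      = ((N : ℂ) ^ D)⁻¹ * ∑ z, w z * ∑ m : TorusSite D N, pw (kFine p m) (repZ z') * pw (-kFine p m) (repZ z) := by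
        have e1 : ∑ m : TorusSite D N, ((N : ℂ) ^ D)⁻¹ * (∑ z, w z * pw (-kFine p m) (repZ z)) * pw (kFine p m) (repZ z')
            = ∑ m : TorusSite D N, ∑ z : TorusSite D N,
                ((N : ℂ) ^ D)⁻¹ * (w z * (pw (kFine p m) (repZ z') * pw (-kFine p m) (repZ z))) := by
          refine Finset.sum_congr rfl fun m _ => ?_
          rw [Finset.mul_sum, Finset.sum_mul]
          exact Finset.sum_congr rfl fun z _ => by ring
        have e2 : ((N : ℂ) ^ D)⁻¹ * ∑ z, w z * ∑ m : TorusSite D N, pw (kFine p m) (repZ z') * pw (-kFine p m) (repZ z)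
            = ∑ z : TorusSite D N, ∑ m : TorusSite D N,
                ((N : ℂ) ^ D)⁻¹ * (w z * (pw (kFine p m) (repZ z') * pw (-kFine p m) (repZ z))) := by
          rw [Finset.mul_sum]
          refine Finset.sum_congr rfl fun z _ => ?_
          rw [Finset.mul_sum, Finset.mul_sum]
        rw [e1, e2, Finset.sum_comm]
    _ = ((N : ℂ) ^ D)⁻¹ * ∑ z, w z * (if z = z' then (N : ℂ) ^ D else 0) := by
        simp_rw [sum_pw_kFine_mul_pw_neg]
    _ = w z' := by
        simp_rw [mul_ite, mul_zero]
        rw [Finset.sum_ite_eq' Finset.univ z', if_pos (Finset.mem_univ _), mul_comm (w z'),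
          inv_mul_cancel_left₀ pow_card_ne_zero]

/-- [folklore] **INVERSION (uniqueness of amplitudes).**  Analysing a synthesis gives back the amplitudes: `amp p (synth p a) = a`. -/
theorem amp_synth (p : Fin D → ℂ) (a : TorusSite D N → ℂ) : amp p (synth p a) = a := by
  funext m
  unfold synth amp
  calc ((N : ℂ) ^ D)⁻¹ * ∑ z : TorusSite D N, (∑ m', a m' * pw (kFine p m') (repZ z)) * pw (-kFine p m) (repZ z)
      = ((N : ℂ) ^ D)⁻¹ * ∑ m', a m' * ∑ z : TorusSite D N, pw (-kFine p m) (repZ z) * pw (kFine p m') (repZ z) := by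
        congr 1
        have e1 : ∑ z : TorusSite D N, (∑ m', a m' * pw (kFine p m') (repZ z)) * pw (-kFine p m) (repZ z)
            = ∑ z : TorusSite D N, ∑ m' : TorusSite D N, a m' * (pw (-kFine p m) (repZ z) * pw (kFine p m') (repZ z)) := by
          refine Finset.sum_congr rfl fun z _ => ?_
          rw [Finset.sum_mul]
          exact Finset.sum_congr rfl fun m' _ => by ring
        have e2 : ∑ m', a m' * ∑ z : TorusSite D N, pw (-kFine p m) (repZ z) * pw (kFine p m') (repZ z)
            = ∑ m' : TorusSite D N, ∑ z : TorusSite D N, a m' * (pw (-kFine p m) (repZ z) * pw (kFine p m') (repZ z)) := by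
          refine Finset.sum_congr rfl fun m' _ => ?_
          rw [Finset.mul_sum]
        rw [e1, e2, Finset.sum_comm]
    _ = ((N : ℂ) ^ D)⁻¹ * ∑ m', a m' * (if m = m' then (N : ℂ) ^ D else 0) := by
        simp_rw [sum_pw_neg_mul_pw_kFine]
    _ = a m := by
        simp_rw [mul_ite, mul_zero]
        rw [Finset.sum_ite_eq Finset.univ m, if_pos (Finset.mem_univ _), mul_comm (a m),
          inv_mul_cancel_left₀ pow_card_ne_zero]

/-- [folklore] The amplitudes are the UNIQUE coefficients of a plane-wave representation on the box. -/
theorem amp_unique (p : Fin D → ℂ) {a : TorusSite D N → ℂ} {w : TorusSite D N → ℂ} (h : synth p a = w) :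
    a = amp p w := by
  rw [← h, amp_synth]

/-- [folklore] The box DFT is injective: box data with equal amplitudes are equal. -/
theorem amp_injective (p : Fin D → ℂ) : Function.Injective (amp (N := N) (D := D) p) := by
  intro w w' h
  rw [← synth_amp p w, ← synth_amp p w', h]

/-! ## §5 Matrix form (for the DFT conjugation of `fibreMatrix`, leaf P1-L04c) -/

/-- [folklore] The SYNTHESIS MATRIX `S_{z m} = pw (k_m) (repZ z)`. -/
def synthMat (p : Fin D → ℂ) : Matrix (TorusSite D N) (TorusSite D N) ℂ :=
  Matrix.of fun z m => pw (kFine p m) (repZ z)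

/-- [folklore] The ANALYSIS MATRIX `A_{m z} = N^{−D} · pw (−k_m) (repZ z)`. -/
def ampMat (p : Fin D → ℂ) : Matrix (TorusSite D N) (TorusSite D N) ℂ :=
  Matrix.of fun m z => ((N : ℂ) ^ D)⁻¹ * pw (-kFine p m) (repZ z)

/-- [folklore] `synthMat p` acts as `synth p`. -/
theorem synthMat_mulVec (p : Fin D → ℂ) (a : TorusSite D N → ℂ) : (synthMat p).mulVec a = synth p a := by
  funext z
  simp only [Matrix.mulVec, dotProduct, synthMat, Matrix.of_apply, synth]
  exact Finset.sum_congr rfl fun m _ => mul_comm _ _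

/-- [folklore] `ampMat p` acts as `amp p`. -/
theorem ampMat_mulVec (p : Fin D → ℂ) (w : TorusSite D N → ℂ) : (ampMat p).mulVec w = amp p w := by
  funext m
  simp only [Matrix.mulVec, dotProduct, ampMat, Matrix.of_apply, amp, Finset.mul_sum]
  exact Finset.sum_congr rfl fun z _ => by ring

/-- [folklore] `S · A = 1` (interpolation). -/
theorem synthMat_mul_ampMat (p : Fin D → ℂ) : synthMat (N := N) (D := D) p * ampMat p = 1 := by
  ext z z'
  simp only [Matrix.mul_apply, synthMat, ampMat, Matrix.of_apply, Matrix.one_apply]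
  calc ∑ m : TorusSite D N, pw (kFine p m) (repZ z) * (((N : ℂ) ^ D)⁻¹ * pw (-kFine p m) (repZ z'))
      = ((N : ℂ) ^ D)⁻¹ * ∑ m : TorusSite D N, pw (kFine p m) (repZ z) * pw (-kFine p m) (repZ z') := by
        rw [Finset.mul_sum]
        exact Finset.sum_congr rfl fun m _ => by ring
    _ = ((N : ℂ) ^ D)⁻¹ * (if z' = z then (N : ℂ) ^ D else 0) := by rw [sum_pw_kFine_mul_pw_neg]
    _ = if z = z' then 1 else 0 := by
        by_cases h : z = z'
        · subst h
          rw [if_pos rfl, if_pos rfl, inv_mul_cancel₀ pow_card_ne_zero]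
        · rw [if_neg (Ne.symm h), if_neg h, mul_zero]

/-- [folklore] `A · S = 1` (uniqueness of amplitudes). -/
theorem ampMat_mul_synthMat (p : Fin D → ℂ) : ampMat (N := N) (D := D) p * synthMat p = 1 := by
  ext m m'
  simp only [Matrix.mul_apply, synthMat, ampMat, Matrix.of_apply, Matrix.one_apply]
  calc ∑ z : TorusSite D N, ((N : ℂ) ^ D)⁻¹ * pw (-kFine p m) (repZ z) * pw (kFine p m') (repZ z)
      = ((N : ℂ) ^ D)⁻¹ * ∑ z : TorusSite D N, pw (-kFine p m) (repZ z) * pw (kFine p m') (repZ z) := by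
        rw [Finset.mul_sum]
        exact Finset.sum_congr rfl fun z _ => by ring
    _ = ((N : ℂ) ^ D)⁻¹ * (if m = m' then (N : ℂ) ^ D else 0) := by rw [sum_pw_neg_mul_pw_kFine]
    _ = if m = m' then 1 else 0 := by
        by_cases h : m = m'
        · subst h
          rw [if_pos rfl, if_pos rfl, inv_mul_cancel₀ pow_card_ne_zero]
        · rw [if_neg h, if_neg h, mul_zero]

end Summit.QuantumFields.BalabanUV.Beta.GAN24.FibreDFT
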